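import Summits.CriticalPhenomena.PercolationContinuityZ3.Theorems.PercNearOneGluingNoHeavyLowerTailSahiC3CubeFourFKG
import Summits.CriticalPhenomena.PercolationContinuityZ3.Theorems.PercNearOneGluingNoHeavyLowerTailSahiCubeThreeAllOrdersBirkhoff
import Summits.CriticalPhenomena.PercolationContinuityZ3.Theorems.PercNearOneGluingNoHeavyLowerTailSahiE3JuntaMeetKahnForm
import Literature.Combinatorics.Sahi2008.Percolation
import HarnessLib
import HarnessLib.Audit

/-!
# `NoHeavyLowerTail` (crux stmt-CriticalPhenomena-4575), Sahi programme P4: corollaries of Sahi's `C₃` on `{0,1}⁴` for every FKG weight, II —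
# the power set `2^X` (`|X| ≤ 4`), Kahn's Conjecture 5 on four coordinates, every FKG poset with at most four join-irreducibles
# (standard axioms)

Support file (cell `prim-l12`, seat P4; `--supports stmt-CriticalPhenomena-4575`).  No named facts, no sorries, no definitions; axioms
`propext`, `Classical.choice`, `Quot.sound` only.  Everything rests on `SahiC3CubeFourFKG.sahiPositive_three_cube_four` (`…SahiC3CubeFourFKG`).

* `exists_cube_embedding_four` + `sahiPositive_three_set_of_card_le_four`: every FKG probability weight on Sahi's power set `Set X`, `|X| ≤ 4`,
  is Sahi-positive of order `3` (lattice embedding `2^X ↪ 2⁴` with a monotone retraction, as in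
  `SahiCubeAllOrders.sahiPositive_set_of_card_le_three`).
* **`kahn_of_card_le_four`**: Kahn's Conjecture 5 [Kahn2022, Conj. 5] for every product measure on `Set ι`, `|ι| ≤ 4`, WITH STANDARD AXIOMS
  (the tree's `SahiC3Cube.sahiC3_cube_four` / `sahiC3_of_card_le_four` are the `native_decide` versions);
  **`kahn_of_inter_determinedBy_card_le_four`**: on EVERY finite index type whenever `A ∩ B` is determined by at most four coordinates
  (locality `SahiE3JuntaMeet.kahn_of_inter_determinedBy`).
* `sahiPositive_three_of_card_supIrred_le_four`: **`SahiConjecture 3` on every finite distributive lattice with at most four join-irreducibles**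
  (Birkhoff transfer `SahiCubeAllOrders.exists_birkhoff_embedding_retract`).
-/

namespace Summit.CriticalPhenomena.PercolationContinuityZ3.Theorems.SahiC3CubeFourFKG

open Finset Literature.Probability.LatticeModels Literature.Combinatorics.Sahi2008 Literature.Probability.Percolation SahiC3Cube

/-! ### Sahi's own setting: the power set `2^X`, `|X| ≤ 4`; Kahn's Conjecture 5 on at most four coordinates -/

section PowerSet

open SahiCubeAllOrders (sahiPositive_of_pushWeight_of_retract)

variable {X : Type*} [Fintype X]

/-- **A lattice embedding `2^X ↪ {0,1}⁴` with a monotone retraction**, for `|X| ≤ 4` (the `Fin 3` version is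
`SahiCubeAllOrders.exists_cube_embedding`; same proof). [this work] -/
theorem exists_cube_embedding_four (ι : X ↪ Fin 4) :
    ∃ (E : Set X → (Fin 4 → Bool)) (R : (Fin 4 → Bool) → Set X), Function.Injective E ∧
      (∀ S T, E (S ⊓ T) = E S ⊓ E T) ∧ (∀ S T, E (S ⊔ T) = E S ⊔ E T) ∧ Monotone R ∧ ∀ S, R (E S) = S := by
  classical
  obtain ⟨E, hE⟩ : ∃ E : Set X → (Fin 4 → Bool), ∀ S t, E S t = true ↔ ∃ x, ι x = t ∧ x ∈ S :=
    ⟨fun S t => decide (∃ x, ι x = t ∧ x ∈ S), fun S t => by simp only [decide_eq_true_eq]⟩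
  obtain ⟨R, hR⟩ : ∃ R : (Fin 4 → Bool) → Set X, ∀ y x, x ∈ R y ↔ y (ι x) = true :=
    ⟨fun y => {x | y (ι x) = true}, fun y x => Iff.rfl⟩
  have hEι : ∀ S x, E S (ι x) = true ↔ x ∈ S := by
    intro S x
    rw [hE]
    constructor
    · rintro ⟨x', hx', hS⟩
      rwa [← ι.injective hx']
    · intro hx
      exact ⟨x, rfl, hx⟩
  have hRE : ∀ S, R (E S) = S := by
    intro S
    ext x
    rw [hR, hEι]
  refine ⟨E, R, fun S T h => by rw [← hRE S, h, hRE], fun S T => ?_, fun S T => ?_, fun y z hyz x hx => ?_, hRE⟩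
  · funext t
    show E (S ∩ T) t = (E S t && E T t)
    rw [Bool.eq_iff_iff, hE, Bool.and_eq_true, hE, hE]
    constructor
    · rintro ⟨x, hx, hS, hT⟩
      exact ⟨⟨x, hx, hS⟩, ⟨x, hx, hT⟩⟩
    · rintro ⟨⟨x, hx, hS⟩, ⟨x', hx', hT⟩⟩
      have hxx : x' = x := ι.injective (hx'.trans hx.symm)
      subst hxx
      exact ⟨x', hx, hS, hT⟩
  · funext t
    show E (S ∪ T) t = (E S t || E T t)
    rw [Bool.eq_iff_iff, hE, Bool.or_eq_true, hE, hE]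
    constructor
    · rintro ⟨x, hx, hS | hT⟩
      · exact Or.inl ⟨x, hx, hS⟩
      · exact Or.inr ⟨x, hx, hT⟩
    · rintro (⟨x, hx, hS⟩ | ⟨x, hx, hT⟩)
      · exact ⟨x, hx, Or.inl hS⟩
      · exact ⟨x, hx, Or.inr hT⟩
  · rw [hR] at hx ⊢
    have h1 : y (ι x) ≤ z (ι x) := hyz (ι x)
    rw [hx] at h1
    exact top_le_iff.1 h1

/-- **Sahi's Conjecture 5 at `n = 3` on the power set `2^X` for `|X| ≤ 4`** [Sahi2008, Conj. 5; `|X| ≤ 2` is Sahi2008 Prop. 15, `|X| ≤ 3`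
(all orders) the tree's `SahiCubeAllOrders.sahiPositive_set_of_card_le_three`]: every FKG probability weight on `Set X` is Sahi-positive of
order `3`. [this work] -/
theorem sahiPositive_three_set_of_card_le_four (hX : Fintype.card X ≤ 4) {μ : Set X → ℝ} (hμ : IsFKGMeasure μ) :
    SahiPositive μ 3 := by
  have hι : Nonempty (X ↪ Fin 4) := by
    rw [Function.Embedding.nonempty_iff_card_le, Fintype.card_fin]
    exact hX
  obtain ⟨ι⟩ := hι
  obtain ⟨E, R, hEinj, hEinf, hEsup, hRmono, hRE⟩ := exists_cube_embedding_four ι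
  have hμ' : IsFKGMeasure (pushWeight μ E) := isFKGMeasure_pushWeight hμ hEinj hEinf hEsup
  exact sahiPositive_of_pushWeight_of_retract hRmono hRE (sahiPositive_three_cube_four hμ')

/-- The same in the shape of the tree's `SahiCubeAllOrders.sahiThreePointLattice` (there: `|X| ≤ 3`, all orders): for every type `X` with at
most four elements and every FKG probability weight on `Set X`, `SahiPositive μ 3`. [this work] -/
theorem sahiFourPointLattice_three :
    ∀ (X : Type) [Fintype X], Fintype.card X ≤ 4 → ∀ μ : Set X → ℝ, IsFKGMeasure μ → SahiPositive μ 3 := by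
  intro X _ hX μ hμ
  exact sahiPositive_three_set_of_card_le_four hX hμ

/-- **Kahn's Conjecture 5 on at most four coordinates, standard axioms**: for a finite index type `ι` with `|ι| ≤ 4`, every
`p : ι → [0,1]` and all increasing `A, B, C ⊆ Set ι`, `0 ≤ sahiE3 (prodBernoulli p) A B C` (the tree's `SahiC3Cube.sahiC3_cube_four` /
`sahiC3_of_card_le_four` give this by `native_decide`; here it follows from `C₃` for all FKG weights on `2⁴`). [this work] -/
theorem kahn_of_card_le_four {ι : Type*} [Fintype ι] (hι : Fintype.card ι ≤ 4) (p : ι → unitInterval) {A B C : Set (Set ι)}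
    (hA : IsUpperSet A) (hB : IsUpperSet B) (hC : IsUpperSet C) : 0 ≤ sahiE3 (prodBernoulli p) A B C :=
  sahiE3_nonneg_of_sahiPositive_upper p (sahiPositive_three_set_of_card_le_four hι (isFKGMeasure_bernoulliWeight p)) hA hB hC

/-- **Kahn's Conjecture 5 whenever `A ∩ B` is determined by at most four coordinates, on every finite index type, standard axioms**
(locality `SahiE3JuntaMeet.kahn_of_inter_determinedBy` + `kahn_of_card_le_four` on the block). [this work] -/
theorem kahn_of_inter_determinedBy_card_le_four {ι : Type*} [Fintype ι] [DecidableEq ι] (p : ι → unitInterval) (W : Finset ι)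
    (hW : W.card ≤ 4) {U A B : Set (Set ι)} (hU : IsUpperSet U) (hA : IsUpperSet A) (hB : IsUpperSet B)
    (hAB : DeterminedBy (A ∩ B) (↑W : Set ι)) : 0 ≤ sahiE3 (prodBernoulli p) U A B := by
  have hcard : Fintype.card ↥W ≤ 4 := by rw [Fintype.card_coe]; exact hW
  exact SahiE3JuntaMeet.kahn_of_inter_determinedBy p W hU hA hB hAB fun q T A' B' hT hA' hB' =>
    kahn_of_card_le_four hcard q hT hA' hB'

end PowerSet

/-! ### Every FKG poset with at most four join-irreducibles -/

section Birkhoff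

open SahiCubeAllOrders (sahiPositive_of_pushWeight_of_retract exists_birkhoff_embedding_retract)

/-- **`SahiConjecture 3` on every finite distributive lattice with at most four join-irreducible elements** (Lieb–Sahi's "FKG posets":
`2^X` for `|X| ≤ 4`, the grids `[3]×[3]`, `[2]×[2]×[3]`, `[2]×[5]`, chains, …): every FKG probability weight is Sahi-positive of order `3`.
Birkhoff transfer (`SahiCubeAllOrders.exists_birkhoff_embedding_retract`, `isFKGMeasure_pushWeight`, `sahiPositive_of_pushWeight_of_retract`)
of `sahiPositive_three_set_of_card_le_four`. [this work] -/
theorem sahiPositive_three_of_card_supIrred_le_four {α : Type*} [DistribLattice α] [Fintype α] [DecidableEq α]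
    (h4 : Nat.card {j : α // SupIrred j} ≤ 4) {μ : α → ℝ} (hμ : IsFKGMeasure μ) : SahiPositive μ 3 := by
  classical
  have hne : Nonempty α := by
    by_contra h
    rw [not_nonempty_iff] at h
    have h0 : ∑ x, μ x = 0 := Fintype.sum_empty _
    have h1 := hμ.sum_eq_one
    rw [h0] at h1
    exact zero_ne_one h1
  obtain ⟨E, R, hEinj, hEinf, hEsup, hRmono, hRE⟩ := exists_birkhoff_embedding_retract (α := α)
  have hcard : Fintype.card {j : α // SupIrred j} ≤ 4 := by
    rwa [← Nat.card_eq_fintype_card]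
  have hμ' : IsFKGMeasure (pushWeight μ E) := isFKGMeasure_pushWeight hμ hEinj hEinf hEsup
  exact sahiPositive_of_pushWeight_of_retract hRmono hRE (sahiPositive_three_set_of_card_le_four hcard hμ')

end Birkhoff

end Summit.CriticalPhenomena.PercolationContinuityZ3.Theorems.SahiC3CubeFourFKG
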